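import Literature.Computability.AlgebraicComplexity.SymmetricCircuitLinComb
import Literature.Computability.AlgebraicComplexity.SymmetricCircuitPairing
import HarnessLib

/-!
# Symmetric circuits: linear combinations of two symmetric circuits (semantics and symmetry)

Topic `Computability/AlgebraicComplexity`, namespace `Literature.Computability.AlgebraicComplexity`.
Continuation of `SymmetricCircuitLinComb.lean` (the gadget `LabelledArithCircuit.LinComb.circuit`
built on a Dawar–Wilsenach labelled circuit `P` with two designated output indices `y₁`, `y₂`
and constants `a`, `b`; A. Dawar, G. Wilsenach, *Symmetric Arithmetic Circuits*, Theory of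
Computing 21 (2025), Defs. 2.2, 3.6, 3.7):

* SEMANTICS (`eval_old`, …, `eval_output`): old gates keep their values, `sa`, `sb` compute the
  constants `a`, `b`, and the output computes `a · out_{y₁} + b · out_{y₂}`;
* SYMMETRY (`isSymmetric_circuit`): an automorphism `π` of `P` extending `γ` (Def. 3.6) extends
  by the identity on the new gates as soon as `γ` fixes `y₁` and `y₂` (constant gates are fixed
  by every automorphism, `IsAutomorphismExtending.apply_eq_self_of_label_const`); so a
  `Γ`-symmetric `P` (Def. 3.7) with `Γ`-fixed `y₁`, `y₂` gives a `Γ`-symmetric gadget;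
* SIZE (`card_gate_le`): at most `|P| + 7` gates;
* the packaged statement `LabelledArithCircuit.IsSymmetric.exists_linComb`: pair two
  `Γ`-symmetric single-output circuits (`Pairing.circuit` of `SymmetricCircuitPairing.lean`,
  outputs `Unit ⊕ Unit`, both indices `Γ`-fixed) and post-compose.

Everything is folklore and proved; nothing here is a named fact.
-/

noncomputable section

open scoped Classical

namespace Literature.Computability.AlgebraicComplexity

open MvPolynomial

universe u v w z w₁ w₂

namespace LabelledArithCircuit

namespace LinComb

variable {K : Type u} {X : Type v} {Y : Type z} {G : Type w}
  {P : LabelledArithCircuit K X Y G} {y₁ y₂ : Y} {a b : K}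

/-! ### Semantics -/

section Eval

variable [CommSemiring K]

/-- Old gates keep their values. [cite: DawarWilsenach2025, §2 (evaluation)] -/
theorem eval_old (g : G) : (circuit P y₁ y₂ a b).eval (.old g) = P.eval g := by
  induction g using P.wf.induction with
  | h g ih =>
    have hlab : (circuit P y₁ y₂ a b).label (.old g) = P.label g := rfl
    have hch : (circuit P y₁ y₂ a b).children (.old g) = (P.children g).map LinCombGate.oldEmb :=
      rfl
    rcases hl : P.label g with x | c | _ | _
    · rw [P.eval_of_label_var hl, (circuit P y₁ y₂ a b).eval_of_label_var (hlab.trans hl)]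
    · rw [P.eval_of_label_const hl, (circuit P y₁ y₂ a b).eval_of_label_const (hlab.trans hl)]
    · rw [P.eval_of_label_add hl, (circuit P y₁ y₂ a b).eval_of_label_add (hlab.trans hl), hch,
        Finset.sum_map]
      exact Finset.sum_congr rfl fun h hh => ih h hh
    · rw [P.eval_of_label_mul hl, (circuit P y₁ y₂ a b).eval_of_label_mul (hlab.trans hl), hch,
        Finset.prod_map]
      exact Finset.prod_congr rfl fun h hh => ih h hh

/-- Constant sources compute their constant. [cite: DawarWilsenach2025, §3.3] -/
theorem eval_csrc (c : K) (hc : c ∈ cset a b) :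
    (circuit P y₁ y₂ a b).eval (csrc c hc) = MvPolynomial.C c :=
  (circuit P y₁ y₂ a b).eval_of_label_const (label_csrc c hc)

/-- `sa` computes `a`. [cite: DawarWilsenach2025, §2 (evaluation)] -/
theorem eval_sa : (circuit P y₁ y₂ a b).eval .sa = MvPolynomial.C a := by
  rw [(circuit P y₁ y₂ a b).eval_of_label_add (show (circuit P y₁ y₂ a b).label .sa = .add from rfl)]
  change ∑ h ∈ ({csrc a (mem_cset a b).1} : Finset (Gate P a b)), _ = _
  rw [Finset.sum_singleton, eval_csrc]

/-- `sb` computes `b`. [cite: DawarWilsenach2025, §2 (evaluation)] -/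
theorem eval_sb : (circuit P y₁ y₂ a b).eval .sb = MvPolynomial.C b := by
  rw [(circuit P y₁ y₂ a b).eval_of_label_add (show (circuit P y₁ y₂ a b).label .sb = .add from rfl)]
  change ∑ h ∈ ({csrc b (mem_cset a b).2} : Finset (Gate P a b)), _ = _
  rw [Finset.sum_singleton, eval_csrc]

/-- `ma` computes `a · out_{y₁}`. [cite: DawarWilsenach2025, §2 (evaluation)] -/
theorem eval_ma :
    (circuit P y₁ y₂ a b).eval .ma = MvPolynomial.C a * P.eval (P.output y₁) := by
  rw [(circuit P y₁ y₂ a b).eval_of_label_mul (show (circuit P y₁ y₂ a b).label .ma = .mul from rfl)]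
  change ∏ h ∈ ({LinCombGate.sa, LinCombGate.old (P.output y₁)} : Finset (Gate P a b)), _ = _
  rw [Finset.prod_pair (by simp), eval_sa, eval_old]

/-- `mb` computes `b · out_{y₂}`. [cite: DawarWilsenach2025, §2 (evaluation)] -/
theorem eval_mb :
    (circuit P y₁ y₂ a b).eval .mb = MvPolynomial.C b * P.eval (P.output y₂) := by
  rw [(circuit P y₁ y₂ a b).eval_of_label_mul (show (circuit P y₁ y₂ a b).label .mb = .mul from rfl)]
  change ∏ h ∈ ({LinCombGate.sb, LinCombGate.old (P.output y₂)} : Finset (Gate P a b)), _ = _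
  rw [Finset.prod_pair (by simp), eval_sb, eval_old]

/-- **Semantics.** The output computes `a · out_{y₁} + b · out_{y₂}`. [cite: DawarWilsenach2025, §2 (evaluation)] -/
theorem eval_output :
    (circuit P y₁ y₂ a b).eval ((circuit P y₁ y₂ a b).output ()) =
      MvPolynomial.C a * P.eval (P.output y₁) + MvPolynomial.C b * P.eval (P.output y₂) := by
  change (circuit P y₁ y₂ a b).eval .out = _
  rw [(circuit P y₁ y₂ a b).eval_of_label_add (show (circuit P y₁ y₂ a b).label .out = .add from rfl)]
  change ∑ h ∈ ({LinCombGate.ma, LinCombGate.mb} : Finset (Gate P a b)), _ = _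
  rw [Finset.sum_pair (by simp), eval_ma, eval_mb]

end Eval

/-! ### Symmetry -/

section Symmetry

variable {Γ : Type*} [Group Γ] [MulAction Γ X] [MulAction Γ Y] {γ : Γ} {π : Equiv.Perm G}

/-- Constant sources are fixed by the extension `LinCombGate.perm π` of an automorphism `π` of `P`
(constant gates are fixed by automorphisms, Def. 3.6). [cite: DawarWilsenach2025, Def. 3.6] -/
theorem perm_csrc (hπ : P.IsAutomorphismExtending γ π) (c : K) (hc : c ∈ cset a b) :
    LinCombGate.perm π (csrc c hc : Gate P a b) = csrc c hc := by
  unfold csrc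
  split_ifs with h
  · change LinCombGate.old (π h.choose) = LinCombGate.old h.choose
    rw [hπ.apply_eq_self_of_label_const h.choose_spec]
  · rfl

variable [MulAction Γ Unit]

/-- **Symmetry.** If `π` is an automorphism of `P` extending `γ` and `γ` fixes the two output
indices `y₁`, `y₂`, then `π` extended by the identity on the new gates is an automorphism of the
linear-combination circuit extending `γ`. [cite: DawarWilsenach2025, Def. 3.6] -/
theorem isAutomorphismExtending_perm (hπ : P.IsAutomorphismExtending γ π) (hy₁ : γ • y₁ = y₁)
    (hy₂ : γ • y₂ = y₂) :
    (circuit P y₁ y₂ a b).IsAutomorphismExtending γ (LinCombGate.perm π) := by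
  refine ⟨fun s => ?_, fun s => ?_, fun _ => rfl⟩
  · cases s with
    | old g =>
      change (P.children (π g)).map LinCombGate.oldEmb =
        ((P.children g).map LinCombGate.oldEmb).map (LinCombGate.perm π).toEmbedding
      rw [hπ.children_apply, Finset.map_map, Finset.map_map]
      rfl
    | ncst c => exact (Finset.map_empty _).symm
    | sa =>
      change ({csrc a (mem_cset a b).1} : Finset (Gate P a b)) =
        ({csrc a (mem_cset a b).1} : Finset (Gate P a b)).map (LinCombGate.perm π).toEmbedding
      rw [Finset.map_singleton, Equiv.coe_toEmbedding, perm_csrc hπ]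
    | sb =>
      change ({csrc b (mem_cset a b).2} : Finset (Gate P a b)) =
        ({csrc b (mem_cset a b).2} : Finset (Gate P a b)).map (LinCombGate.perm π).toEmbedding
      rw [Finset.map_singleton, Equiv.coe_toEmbedding, perm_csrc hπ]
    | ma =>
      change ({LinCombGate.sa, LinCombGate.old (P.output y₁)} : Finset (Gate P a b)) =
        ({LinCombGate.sa, LinCombGate.old (P.output y₁)} : Finset (Gate P a b)).map
          (LinCombGate.perm π).toEmbedding
      rw [Finset.map_insert, Finset.map_singleton, Equiv.coe_toEmbedding]
      change _ = insert LinCombGate.sa {LinCombGate.old (π (P.output y₁))}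
      rw [← hπ.output_smul y₁, hy₁]
    | mb =>
      change ({LinCombGate.sb, LinCombGate.old (P.output y₂)} : Finset (Gate P a b)) =
        ({LinCombGate.sb, LinCombGate.old (P.output y₂)} : Finset (Gate P a b)).map
          (LinCombGate.perm π).toEmbedding
      rw [Finset.map_insert, Finset.map_singleton, Equiv.coe_toEmbedding]
      change _ = insert LinCombGate.sb {LinCombGate.old (π (P.output y₂))}
      rw [← hπ.output_smul y₂, hy₂]
    | out =>
      change ({LinCombGate.ma, LinCombGate.mb} : Finset (Gate P a b)) =
        ({LinCombGate.ma, LinCombGate.mb} : Finset (Gate P a b)).map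
          (LinCombGate.perm π).toEmbedding
      rw [Finset.map_insert, Finset.map_singleton]
      rfl
  · cases s with
    | old g => exact hπ.label_apply g
    | _ => rfl

/-- A `Γ`-symmetric `P` whose output indices `y₁`, `y₂` are `Γ`-fixed gives a `Γ`-symmetric
linear-combination circuit (Def. 3.7). [cite: DawarWilsenach2025, Def. 3.7] -/
theorem isSymmetric_circuit (hsym : P.IsSymmetric Γ) (hy₁ : ∀ γ : Γ, γ • y₁ = y₁)
    (hy₂ : ∀ γ : Γ, γ • y₂ = y₂) : (circuit P y₁ y₂ a b).IsSymmetric Γ := by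
  intro γ
  obtain ⟨π, hπ⟩ := hsym γ
  exact ⟨LinCombGate.perm π, isAutomorphismExtending_perm hπ (hy₁ γ) (hy₂ γ)⟩

end Symmetry

/-! ### Size -/

/-- `|NC| ≤ 2`. [cite: DawarWilsenach2025, Def. 2.2 (size)] -/
theorem card_NC_le : Fintype.card (NC P a b) ≤ 2 := by
  calc Fintype.card (NC P a b) = ((cset a b).filter fun c => ∀ g, P.label g ≠ .const c).card :=
        Fintype.subtype_card _ _
    _ ≤ (cset a b).card := Finset.card_filter_le _ _
    _ ≤ 2 := Finset.card_le_two

/-- **Size.** The linear-combination circuit has at most `|G| + 7` gates. [cite: DawarWilsenach2025, Def. 2.2 (size)] -/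
theorem card_gate_le [Fintype G] : Fintype.card (Gate P a b) ≤ Fintype.card G + 7 := by
  rw [Fintype.card_congr LinCombGate.equivSum]
  simp only [Fintype.card_sum, Fintype.card_fin]
  have h := card_NC_le (P := P) (a := a) (b := b)
  omega

end LinComb

/-- **Linear combinations of symmetric circuits.** For any group `Γ` acting on the variables `X`:
two `Γ`-symmetric single-output labelled circuits `C₁`, `C₂` over `K`, `X` and constants
`a, b ∈ K` yield a `Γ`-symmetric single-output labelled circuit computing
`a · C₁ + b · C₂` with at most `|G₁| + |G₂| + 8` gates (pair the circuits,
`IsSymmetric.exists_pairing` / `Pairing.circuit`, then post-compose with `LinComb.circuit`;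
Dawar–Wilsenach Defs. 2.2, 3.6, 3.7). [cite: DawarWilsenach2025, Def. 3.7] -/
theorem IsSymmetric.exists_linComb {K : Type u} [CommSemiring K] {X : Type v} {Γ : Type*}
    [Group Γ] [MulAction Γ X] [MulAction Γ Unit] {G₁ : Type w₁} {G₂ : Type w₂} [Fintype G₁]
    [Fintype G₂] (C₁ : LabelledArithCircuit K X Unit G₁) (C₂ : LabelledArithCircuit K X Unit G₂)
    (h₁ : C₁.IsSymmetric Γ) (h₂ : C₂.IsSymmetric Γ) (a b : K) :
    ∃ (G : Type (max u w₁ w₂)) (_ : Fintype G) (C : LabelledArithCircuit K X Unit G),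
      C.IsSymmetric Γ ∧
      C.eval (C.output ()) =
        MvPolynomial.C a * C₁.eval (C₁.output ()) + MvPolynomial.C b * C₂.eval (C₂.output ()) ∧
      Fintype.card G ≤ Fintype.card G₁ + Fintype.card G₂ + 8 := by
  refine ⟨LinComb.Gate (Pairing.circuit C₁ C₂) a b, inferInstance,
    LinComb.circuit (Pairing.circuit C₁ C₂) (Sum.inl ()) (Sum.inr ()) a b,
    LinComb.isSymmetric_circuit (Pairing.isSymmetric h₁ h₂) (fun γ => ?_) (fun γ => ?_), ?_, ?_⟩
  · rw [Sum.smul_inl]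
  · rw [Sum.smul_inr]
  · rw [LinComb.eval_output, Pairing.eval_output_inl, Pairing.eval_output_inr]
  · calc Fintype.card (LinComb.Gate (Pairing.circuit C₁ C₂) a b)
        ≤ Fintype.card (G₁ ⊕ G₂) + 7 := LinComb.card_gate_le
      _ ≤ Fintype.card G₁ + Fintype.card G₂ + 8 := by rw [Fintype.card_sum]; omega

end LabelledArithCircuit

end Literature.Computability.AlgebraicComplexity

end
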